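import Literature.NumberTheory.GaloisCohomology.CyclicClassLocalArtinSymbol
import HarnessLib

/-!
# The local invariant of a cyclic class is the local Artin symbol, III: every LOCAL `b ∈ K_vˣ`
# (Serre, *Corps locaux* XIV §1 Prop. 3: `(χ, b)_v = χ(s_b)` — the norm residue symbol at a completion)

Let `K` be a number field, `n ≥ 1`, `ψ : Γ_K ↠ ℤ/n` a cyclic character cutting out the finite abelian
`L ⊆ K̄` (`ker ψ = Gal(K̄/L)`), `v` a finite place, `F = K_v`, `θ : Γ_F ↠ ℤ/n` the restriction of `ψ` to the
decomposition group (`ψ ∘ res_v = θ`), `inv_n = Prop121vii.invLevel F n` THE residue map of `F` and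
`Art_F = canonicalArtin F : W_F → Fˣ` THE local Artin map (Deligne's normalisation).

**Theorem** (`invLevel_cupProduct_δ₀_scalarCocycle_eq_neg_apply_of_restrict`).  For EVERY `x ∈ Fˣ` — local,
not only for the global `b ∈ Kˣ` of part II (`localInvariantMap_localization_cupProduct_δ₀_eq_neg_apply`) —
and every `w ∈ W_F` with `Art_F w = x`,

  `inv_n (κₙ(x) ∪ [θ·id]) = -θ(w)`

in `ℤ/n`, in the LOCAL currency of `invLevel_cupProduct_kummer_scalarCocycle_of_unramified` (the Kummer class
`κₙ(x) = δ₀(x) ∈ H¹(Γ_F, μₙ(F̄))`, the cup product `H¹(μₙ) × H¹(μₙ^∨(1)) → H²(μₙ)` of the tree, the crossed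
homomorphism `σ ↦ θ(σ)·id`).  This is Serre's `(χ, b)_v = χ((b, */K_v))` for the RAMIFIED characters `χ = θ`
that are restrictions of global cyclic characters, now for all local `b`: the levelwise form of the explicit
reciprocity law of `𝔾_m` (Kato, LNM 1553, Ch. II Lemma 1.4.5, `⟨exp(a), log χ_cyclo⟩ = -Tr_{K/ℚ_p}(a)`, "well
known in local class field theory") at completions of number fields, once `θ` is a layer of the cyclotomic
character (`cyclotomicCharacter_artin_eq_norm_holds` then evaluates `θ(w)` through `N_{F/ℚ_p}(Art_F w)`).

Proof (density, as in part II §2 but purely local at `v`): both sides are additive in `x ∈ Fˣ`; the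
invariant side kills the `n`-th powers (`δ₀_baseUnitsInvariant_pow_eq_zero`), the Artin side — read through the
GLOBAL Artin map `ψ̄ ∘ ψ_{L|K} ∘ ⟨·⟩_v`, which is `w ↦ ((res w)|_L)⁻¹` on `Art_F w`
(`artinIdeleMap_localUnits_canonicalArtin_eq_inv`) — kills the local norms from the compositum `F·L`
(`artinIdeleMap_localUnits_eq_one_iff_mem_range_norm`); `U = N ∩ (Fˣ)ⁿ` is open (`LocalUnitGroupFiniteIndexOpen`),
`K` is dense in `K_v` (Mathlib `HeightOneSpectrum.denseRange_algebraMap`), so `x = b · u` with `b ∈ Kˣ`, `u ∈ U`,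
and for `b` the identity is part II transported to the local currency by `localInvariantMap_localization` and
`Prop121vii.resMu_cupProduct_δ₀_scalarCocycle` (`Res_{K_v/K}(κₙ(b) ∪ [ψ·id]) = κₙ(b) ∪ [θ·id]`).

Also: `invLevel_cupProduct_δ₀_scalarCocycle_canonicalArtin_eq_neg_apply` (the form `x = Art_F w`),
`cupProduct_δ₀_scalarCocycle_eq_zero_iff_apply_eq_zero` (`κₙ(x) ∪ [θ·id] = 0 ↔ θ(w) = 0`, `inv_n` being
injective) and `invLevel_cupProduct_δ₀_scalarCocycle_eq_zero_of_mem_range_norm` (local norms from `F·L`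
have trivial symbol).

Proof file: theorems only (no definition, no named fact, no instance; D-0026).  HONEST FRAMING: textbook
local class field theory at completions of number fields (the restriction hypothesis `ψ ∘ res_v = θ` replaces
the Grunwald–Wang step that would produce `ψ` from an arbitrary local `θ`); one floor ((d), levelwise, at
completions) of the programme for Kato's explicit reciprocity law [REC] of crux K★ `stmt-BirchSwinnertonDyer-22226`
(memos `Summits/…/Cruxes/StarredOptimalManinUnitFiveSeven/Lines/kato-lever-K3-programme.md` §2,
`…-K3-floor-c.md` §2); it proves no case of Poitou–Tate beyond the tree's and no case of BSD.

## References

* J.-P. Serre, *Corps locaux* / *Local Fields* (1979), XIV §1 Prop. 3, XIII §4. [SerreLocalFields1979]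
* J. Tate, *Global class field theory*, Ch. VII of Cassels–Fröhlich (1967), §10–§11. [CasselsFrohlichANT1967]
* J. Neukirch, *Algebraic Number Theory* (1999), VI (5.6)–(5.8). [NeukirchANT1999]
* K. Kato, *Lectures on the approach to Iwasawa theory for Hasse–Weil L-functions via B_dR, Part I*,
  LNM 1553 (1993), Ch. II 1.4.2, Lemma 1.4.5. [Kato1993LNM1553]

## Tree search

`lean search 'invLevel_cupProduct|localization_cupProduct_δ₀_eq_neg'`: part II (global `b`), the unramified
evaluations (`invLevel_cupProduct_δ₀`, `…_of_unramified`); no local-`b` ramified evaluation.  Inputs: part II,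
`localInvariantMap_localization`, `Prop121vii.resMu_cupProduct_δ₀_scalarCocycle`,
`KummerClassLocalPower.δ₀_baseUnitsInvariant_pow_eq_zero`, `ArtinMapLocalNormKernel`
(`artinIdeleMap_localUnits_canonicalArtin_eq_inv`, `artinIdeleMap_localUnits_eq_one_iff_mem_range_norm`,
`index_range_norm_ne_zero`), `LocalUnitGroupFiniteIndexOpen`, Mathlib `HeightOneSpectrum.denseRange_algebraMap`,
`Units.isEmbedding_val₀`.
-/

noncomputable section

open CategoryTheory Function NumberField IsDedekindDomain Field ValuativeRel
open scoped NumberField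

namespace Literature.NumberTheory.GaloisCohomology

open _root_.ContinuousCohomology
open Literature.NumberTheory.GaloisRepresentations
open Literature.NumberTheory.GaloisRepresentations.DiscreteGaloisModule
open Literature.NumberTheory.GaloisRepresentations.LocalWeilDatum
open Literature.NumberTheory.GaloisRepresentations.IsNonarchimedeanLocalField
open Literature.NumberTheory.NumberFields
open Literature.AnabelianGeometry.AbsoluteAnabelian
open Literature.AnabelianGeometry.AbsoluteAnabelian.Prop121vii

variable {K : Type} [Field K] [NumberField K] {n : ℕ} [NeZero n]
  (L : IntermediateField K (AlgebraicClosure K)) [FiniteDimensional K L] [IsAbelianGalois K L]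
  [NumberField L]

/-! ### §1. Part II in the local currency (global `b`) -/

section GlobalB

variable (v : HeightOneSpectrum (𝓞 K))

/-- **Part II read in the local currency of `K_v`**: for a GLOBAL `b ∈ Kˣ`, `θ = ψ ∘ res_v` and `Art_v w = b`,
`inv_n (κₙ(b) ∪ [θ·id]) = -θ(w)` with `κₙ(b) ∈ H¹(Γ_{K_v}, μₙ(K̄_v))` the LOCAL Kummer class — part II
(`localInvariantMap_localization_cupProduct_δ₀_eq_neg_apply`, stated on the localisation of the global class)
transported by `localInvariantMap_localization` and `Res_{K_v/K}(κₙ(b) ∪ [ψ·id]) = κₙ(b) ∪ [θ·id]`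
(`Prop121vii.resMu_cupProduct_δ₀_scalarCocycle` with `f = 1`). [cite: SerreLocalFields1979, XIV §1 Prop. 3] -/
theorem invLevel_cupProduct_δ₀_scalarCocycle_algebraMap_eq_neg_apply
    (ψ : CyclicCharacter (absoluteGaloisGroup K) n) (hker : ψ.ker = galFixing K L)
    (θ : CyclicCharacter (absoluteGaloisGroup (v.adicCompletion K)) n)
    (hθ : ∀ σ : absoluteGaloisGroup (v.adicCompletion K), ψ (absGaloisRestrict K (v.adicCompletion K) σ) = θ σ)
    (b : Kˣ) (hb : algebraMap K (v.adicCompletion K) (b : K) ≠ 0) (w : WeilGroup (v.adicCompletion K))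
    (hw : canonicalArtin (v.adicCompletion K) w = globalToLocalUnits v b) :
    haveI : CompactSpace (absoluteGaloisGroup (v.adicCompletion K)) := absoluteGaloisGroup_compactSpace _
    haveI : CharZero (v.adicCompletion K) := charZero_adicCompletion v
    invLevel (v.adicCompletion K) n (((mu (v.adicCompletion K) n).tateDualPairing n).cupProduct
        ((isSES_kummer (v.adicCompletion K) n (NeZero.pos n)).δ₀
          (baseUnitsInvariant (v.adicCompletion K) (algebraMap K (v.adicCompletion K) (b : K)) hb))
        (oneCocycleClass _ (scalarCocycle θ))) =
      -θ (WeilGroup.toAbsGalois (v.adicCompletion K) w) := by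
  haveI : CompactSpace (absoluteGaloisGroup K) := absoluteGaloisGroup_compactSpace K
  haveI : CompactSpace (absoluteGaloisGroup (v.adicCompletion K)) := absoluteGaloisGroup_compactSpace _
  haveI : CharZero (v.adicCompletion K) := charZero_adicCompletion v
  have h := localInvariantMap_localization_cupProduct_δ₀_eq_neg_apply L ψ hker b v w hw
  rw [localInvariantMap_localization] at h
  have hθ' : ∀ σ : absoluteGaloisGroup (v.adicCompletion K),
      ψ (absGaloisRestrict K (v.adicCompletion K) σ) = ((1 : ℕ) : ZMod n) * θ σ := fun σ => by
    rw [Nat.cast_one, one_mul]; exact hθ σ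
  have hres := resMu_cupProduct_δ₀_scalarCocycle K (v.adicCompletion K) ψ θ hθ' (b : K) b.ne_zero hb
  rw [Nat.cast_one, one_smul] at hres
  change invLevel (v.adicCompletion K) n (resMu K (v.adicCompletion K) n 2 _) = _ at h
  rw [hres] at h
  rw [h, hθ]

end GlobalB

/-! ### §2. Every local `x ∈ K_vˣ` -/

section LocalB

variable (v : HeightOneSpectrum (𝓞 K))

/-- `baseUnitsInvariant` only depends on the element (proof-irrelevance helper). [folklore] -/
private theorem baseUnitsInvariant_congr'' {E : Type} [Field E] {x y : E} (hx : x ≠ 0) (hy : y ≠ 0)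
    (h : x = y) : baseUnitsInvariant E x hx = baseUnitsInvariant E y hy := by
  subst h; rfl

/-- **Serre, *Corps locaux* XIV §1 Prop. 3 — `(χ, b)_v = χ(s_b)` — at a completion `K_v`, for EVERY local
`x ∈ K_vˣ`**: with `ψ : Γ_K ↠ ℤ/n` global cyclic (`ker ψ = Gal(K̄/L)`), `θ : Γ_{K_v} ↠ ℤ/n` its restriction
(`ψ ∘ res_v = θ`), `x ∈ K_v`, `x ≠ 0`, and `w ∈ W_{K_v}` with `Art_v w = x` (THE local Artin map, Deligne's
normalisation): THE residue map of `K_v` evaluates the local cyclic class as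

  `inv_n (κₙ(x) ∪ [θ·id]) = -θ(w)`.

Density argument: both sides are characters of `K_vˣ` trivial on the open subgroup `N_{K_vL/K_v} ∩ (K_vˣ)ⁿ`
and they agree on the dense image of `Kˣ` (§1). [cite: SerreLocalFields1979, XIV §1 Prop. 3]
[cite: CasselsFrohlichANT1967, Ch. VII §11] [cite: NeukirchANT1999, Ch. VI §5 (5.6)–(5.8)] -/
theorem invLevel_cupProduct_δ₀_scalarCocycle_eq_neg_apply_of_restrict
    (ψ : CyclicCharacter (absoluteGaloisGroup K) n) (hker : ψ.ker = galFixing K L)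
    (θ : CyclicCharacter (absoluteGaloisGroup (v.adicCompletion K)) n)
    (hθ : ∀ σ : absoluteGaloisGroup (v.adicCompletion K), ψ (absGaloisRestrict K (v.adicCompletion K) σ) = θ σ)
    (x : v.adicCompletion K) (hx : x ≠ 0) (w : WeilGroup (v.adicCompletion K))
    (hw : ((canonicalArtin (v.adicCompletion K) w : (v.adicCompletion K)ˣ) : v.adicCompletion K) = x) :
    haveI : CompactSpace (absoluteGaloisGroup (v.adicCompletion K)) := absoluteGaloisGroup_compactSpace _
    haveI : CharZero (v.adicCompletion K) := charZero_adicCompletion v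
    invLevel (v.adicCompletion K) n (((mu (v.adicCompletion K) n).tateDualPairing n).cupProduct
        ((isSES_kummer (v.adicCompletion K) n (NeZero.pos n)).δ₀ (baseUnitsInvariant (v.adicCompletion K) x hx))
        (oneCocycleClass _ (scalarCocycle θ))) =
      -θ (WeilGroup.toAbsGalois (v.adicCompletion K) w) := by
  classical
  haveI : CompactSpace (absoluteGaloisGroup K) := absoluteGaloisGroup_compactSpace K
  haveI : CompactSpace (absoluteGaloisGroup (v.adicCompletion K)) := absoluteGaloisGroup_compactSpace _
  haveI : CharZero (v.adicCompletion K) := charZero_adicCompletion v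
  have ha := isLocalArtinMap_canonicalArtin_holds (v.adicCompletion K)
  obtain ⟨ψbar, hψbar_apply⟩ := exists_character_absRestrictNormalHom_eq L ψ hker
  -- carrier-typed aliases
  let ι : continuousCohomology 2 (mu (v.adicCompletion K) n).toTopRep →+ ZMod n := invLevel (v.adicCompletion K) n
  let P := (mu (v.adicCompletion K) n).tateDualPairing n
  let g := oneCocycleClass ((mu (v.adicCompletion K) n).tateDual n).toTopRep (scalarCocycle θ)
  let δ := (isSES_kummer (v.adicCompletion K) n (NeZero.pos n)).δ₀
  -- the two sides as functions of `y ∈ K_vˣ`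
  set I : (v.adicCompletion K)ˣ → ZMod n := fun y =>
    ι (P.cupProduct (δ (baseUnitsInvariant (v.adicCompletion K) (y : v.adicCompletion K) y.ne_zero)) g) with hI
  set R : (v.adicCompletion K)ˣ →* Multiplicative (ZMod n) :=
    ψbar.comp ((artinIdeleMap L artinReciprocity_character_holds).comp (localUnits v)) with hRdef
  have hRapply : ∀ y : (v.adicCompletion K)ˣ,
      R y = ψbar (artinIdeleMap L artinReciprocity_character_holds (localUnits v y)) := fun y => rfl
  -- `R (Art_v w') = -ψ(res w') = -θ(w')`
  have hR_art : ∀ w' : WeilGroup (v.adicCompletion K),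
      Multiplicative.toAdd (R (canonicalArtin (v.adicCompletion K) w')) =
        -θ (WeilGroup.toAbsGalois (v.adicCompletion K) w') := fun w' => by
    rw [hRapply, artinIdeleMap_localUnits_canonicalArtin_eq_inv L w', map_inv, hψbar_apply, toAdd_inv,
      toAdd_ofAdd, hθ]
  -- additivity of `I`
  have hadd : ∀ a b : continuousCohomology 1 (mu (v.adicCompletion K) n).toTopRep,
      P.cupProduct (a + b) g = P.cupProduct a g + P.cupProduct b g := fun a b => by
    rw [map_add, LinearMap.add_apply]
  have hImul : ∀ y₁ y₂ : (v.adicCompletion K)ˣ, I (y₁ * y₂) = I y₁ + I y₂ := by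
    intro y₁ y₂
    have hbase : baseUnitsInvariant (v.adicCompletion K) ((y₁ * y₂ : (v.adicCompletion K)ˣ) : v.adicCompletion K)
          (y₁ * y₂).ne_zero =
        baseUnitsInvariant (v.adicCompletion K) (y₁ : v.adicCompletion K) y₁.ne_zero +
          baseUnitsInvariant (v.adicCompletion K) (y₂ : v.adicCompletion K) y₂.ne_zero :=
      baseUnitsInvariant_mul (v.adicCompletion K) _ _ y₁.ne_zero y₂.ne_zero
    simp only [hI]
    rw [hbase, map_add δ, hadd, map_add ι]
  -- the local norm group `N_v`; `R` kills it
  set Nv : Subgroup (v.adicCompletion K)ˣ := (Units.map (Algebra.norm (v.adicCompletion K) :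
      (IntermediateField.adjoin (v.adicCompletion K)
        (Set.range ((absClosureEmbedding K (v.adicCompletion K)).comp L.val))) →* v.adicCompletion K)).range
    with hNv
  have hR_norm : ∀ y ∈ Nv, R y = 1 := fun y hy => by
    rw [hRapply, (artinIdeleMap_localUnits_eq_one_iff_mem_range_norm L y).mpr hy, map_one]
  -- `I` kills the `n`-th powers
  have hI_pow : ∀ u : (v.adicCompletion K)ˣ,
      u ∈ (powMonoidHom n : (v.adicCompletion K)ˣ →* (v.adicCompletion K)ˣ).range → I u = 0 := by
    rintro u ⟨t, rfl⟩
    simp only [hI]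
    rw [baseUnitsInvariant_congr'' (powMonoidHom n t).ne_zero (pow_ne_zero n t.ne_zero)
      (by rw [powMonoidHom_apply, Units.val_pow_eq_pow_val]),
      δ₀_baseUnitsInvariant_pow_eq_zero (v.adicCompletion K) (t : v.adicCompletion K) t.ne_zero,
      map_zero P.cupProduct, LinearMap.zero_apply, map_zero ι]
  -- §1 for global `b`: `I b = R b`
  have hglob : ∀ b : Kˣ, I (globalToLocalUnits v b) =
      Multiplicative.toAdd (R (globalToLocalUnits v b)) := by
    intro b
    obtain ⟨w₁, hw₁⟩ := ha.isOpenQuotientMap_artin.surjective (globalToLocalUnits v b)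
    have hb : algebraMap K (v.adicCompletion K) (b : K) ≠ 0 :=
      (map_ne_zero_iff _ (algebraMap K (v.adicCompletion K)).injective).2 b.ne_zero
    have h : ι (P.cupProduct (δ (baseUnitsInvariant (v.adicCompletion K)
        (algebraMap K (v.adicCompletion K) (b : K)) hb)) g) = -θ (WeilGroup.toAbsGalois (v.adicCompletion K) w₁) :=
      invLevel_cupProduct_δ₀_scalarCocycle_algebraMap_eq_neg_apply L v ψ hker θ hθ b hb w₁ hw₁
    simp only [hI]
    rw [baseUnitsInvariant_congr'' (globalToLocalUnits v b).ne_zero hb (val_globalToLocalUnits v b), h,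
      ← hR_art w₁, hw₁]
  -- the open subgroup `U = N_v ∩ (K_vˣ)^n`
  set U : Subgroup (v.adicCompletion K)ˣ :=
    Nv ⊓ (powMonoidHom n : (v.adicCompletion K)ˣ →* (v.adicCompletion K)ˣ).range with hU
  have hUopen : IsOpen (U : Set (v.adicCompletion K)ˣ) := by
    haveI : Nv.FiniteIndex := ⟨index_range_norm_ne_zero L⟩
    have h1 : IsOpen (Nv : Set (v.adicCompletion K)ˣ) :=
      Subgroup.isOpen_of_finiteIndex_units_localField (K := v.adicCompletion K) Nv
    have h2 : IsOpen (((powMonoidHom n : (v.adicCompletion K)ˣ →* (v.adicCompletion K)ˣ).range :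
        Subgroup (v.adicCompletion K)ˣ) : Set (v.adicCompletion K)ˣ) :=
      isOpen_range_powMonoidHom_units (v.adicCompletion K) (Nat.cast_ne_zero.mpr (NeZero.ne n))
    exact h1.inter h2
  -- `Units.val : K_vˣ → K_v` is an open embedding
  have hvalopen : IsOpenMap (Units.val : (v.adicCompletion K)ˣ → v.adicCompletion K) := by
    have hrange : Set.range (Units.val : (v.adicCompletion K)ˣ → v.adicCompletion K) = {0}ᶜ := by
      ext z
      simp only [Set.mem_range, Set.mem_compl_iff, Set.mem_singleton_iff]
      exact ⟨fun ⟨u, hu⟩ => hu ▸ u.ne_zero, fun hz => ⟨Units.mk0 z hz, rfl⟩⟩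
    exact (⟨Units.isEmbedding_val₀, by rw [hrange]; exact isOpen_compl_singleton⟩ :
      Topology.IsOpenEmbedding (Units.val : (v.adicCompletion K)ˣ → v.adicCompletion K)).isOpenMap
  -- density of `K` in `K_v`: `x = b · u` with `b ∈ Kˣ`, `u ∈ U`
  set y : (v.adicCompletion K)ˣ := Units.mk0 x hx with hy
  set C : Set (v.adicCompletion K)ˣ := (fun z => y⁻¹ * z) ⁻¹' (U : Set (v.adicCompletion K)ˣ) with hCdef
  have hCopen : IsOpen C := hUopen.preimage (continuous_const_mul _)
  have hyC : y ∈ C := by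
    change y⁻¹ * y ∈ (U : Set (v.adicCompletion K)ˣ)
    rw [inv_mul_cancel]
    exact U.one_mem
  obtain ⟨k, z', hz'C, hz'k⟩ :=
    (HeightOneSpectrum.denseRange_algebraMap (K := K) (v := v)).exists_mem_open (hvalopen _ hCopen)
      ⟨(y : v.adicCompletion K), y, hyC, rfl⟩
  -- `k ≠ 0` and the unit `b`
  have hk0 : k ≠ 0 := by
    intro h
    exact z'.ne_zero (by rw [hz'k, h, map_zero])
  set b : Kˣ := Units.mk0 k hk0 with hb
  have hbz : globalToLocalUnits v b = z' :=
    Units.ext (by rw [val_globalToLocalUnits, hz'k]; rfl)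
  -- `u = y⁻¹ z'` lies in `U`
  set u : (v.adicCompletion K)ˣ := y⁻¹ * z' with hu
  have huU : u ∈ U := hz'C
  have hRu : R u = 1 := hR_norm _ (Subgroup.mem_inf.mp huU).1
  have hIu : I u = 0 := hI_pow u (Subgroup.mem_inf.mp huU).2
  -- conclude
  have hzyu : z' = y * u := by rw [hu, mul_inv_cancel_left]
  have hIy : I y = Multiplicative.toAdd (R y) := by
    have h := hglob b
    rw [hbz, hzyu, hImul, hIu, add_zero, map_mul, hRu, mul_one] at h
    exact h
  have hyw : canonicalArtin (v.adicCompletion K) w = y := Units.ext (by rw [hw]; rfl)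
  have hfin : I y = -θ (WeilGroup.toAbsGalois (v.adicCompletion K) w) := by rw [hIy, ← hyw, hR_art]
  simp only [hI] at hfin
  exact hfin

/-- **The same with `x = Art_v w`**: `inv_n (κₙ(Art_v w) ∪ [θ·id]) = -θ(w)` for every `w ∈ W_{K_v}`.
[cite: SerreLocalFields1979, XIV §1 Prop. 3] -/
theorem invLevel_cupProduct_δ₀_scalarCocycle_canonicalArtin_eq_neg_apply
    (ψ : CyclicCharacter (absoluteGaloisGroup K) n) (hker : ψ.ker = galFixing K L)
    (θ : CyclicCharacter (absoluteGaloisGroup (v.adicCompletion K)) n)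
    (hθ : ∀ σ : absoluteGaloisGroup (v.adicCompletion K), ψ (absGaloisRestrict K (v.adicCompletion K) σ) = θ σ)
    (w : WeilGroup (v.adicCompletion K)) :
    haveI : CompactSpace (absoluteGaloisGroup (v.adicCompletion K)) := absoluteGaloisGroup_compactSpace _
    haveI : CharZero (v.adicCompletion K) := charZero_adicCompletion v
    invLevel (v.adicCompletion K) n (((mu (v.adicCompletion K) n).tateDualPairing n).cupProduct
        ((isSES_kummer (v.adicCompletion K) n (NeZero.pos n)).δ₀ (baseUnitsInvariant (v.adicCompletion K)
          ((canonicalArtin (v.adicCompletion K) w : (v.adicCompletion K)ˣ) : v.adicCompletion K)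
          (canonicalArtin (v.adicCompletion K) w).ne_zero))
        (oneCocycleClass _ (scalarCocycle θ))) =
      -θ (WeilGroup.toAbsGalois (v.adicCompletion K) w) :=
  invLevel_cupProduct_δ₀_scalarCocycle_eq_neg_apply_of_restrict L v ψ hker θ hθ _ _ w rfl

/-- **`κₙ(x) ∪ [θ·id] = 0 ↔ θ(w) = 0`** (`Art_v w = x`): the local cyclic class of `x ∈ K_vˣ` vanishes in
`H²(Γ_{K_v}, μₙ)` iff `θ` kills `w`, THE residue map `inv_n` being injective (`isInvariantMap_invLevel`).
[cite: SerreLocalFields1979, XIV §1 Prop. 3 and Cor.] -/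
theorem cupProduct_δ₀_scalarCocycle_eq_zero_iff_apply_eq_zero
    (ψ : CyclicCharacter (absoluteGaloisGroup K) n) (hker : ψ.ker = galFixing K L)
    (θ : CyclicCharacter (absoluteGaloisGroup (v.adicCompletion K)) n)
    (hθ : ∀ σ : absoluteGaloisGroup (v.adicCompletion K), ψ (absGaloisRestrict K (v.adicCompletion K) σ) = θ σ)
    (x : v.adicCompletion K) (hx : x ≠ 0) (w : WeilGroup (v.adicCompletion K))
    (hw : ((canonicalArtin (v.adicCompletion K) w : (v.adicCompletion K)ˣ) : v.adicCompletion K) = x) :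
    haveI : CompactSpace (absoluteGaloisGroup (v.adicCompletion K)) := absoluteGaloisGroup_compactSpace _
    ((mu (v.adicCompletion K) n).tateDualPairing n).cupProduct
        ((isSES_kummer (v.adicCompletion K) n (NeZero.pos n)).δ₀ (baseUnitsInvariant (v.adicCompletion K) x hx))
        (oneCocycleClass _ (scalarCocycle θ)) = 0 ↔
      θ (WeilGroup.toAbsGalois (v.adicCompletion K) w) = 0 := by
  haveI : CompactSpace (absoluteGaloisGroup (v.adicCompletion K)) := absoluteGaloisGroup_compactSpace _
  haveI : CharZero (v.adicCompletion K) := charZero_adicCompletion v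
  let ι : continuousCohomology 2 (mu (v.adicCompletion K) n).toTopRep →+ ZMod n := invLevel (v.adicCompletion K) n
  have h : ι (((mu (v.adicCompletion K) n).tateDualPairing n).cupProduct
      ((isSES_kummer (v.adicCompletion K) n (NeZero.pos n)).δ₀ (baseUnitsInvariant (v.adicCompletion K) x hx))
      (oneCocycleClass _ (scalarCocycle θ))) = -θ (WeilGroup.toAbsGalois (v.adicCompletion K) w) :=
    invLevel_cupProduct_δ₀_scalarCocycle_eq_neg_apply_of_restrict L v ψ hker θ hθ x hx w hw
  constructor
  · intro h0
    rw [h0, map_zero ι] at h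
    exact neg_eq_zero.mp h.symm
  · intro h0
    rw [h0, neg_zero] at h
    exact (isInvariantMap_invLevel (v.adicCompletion K) n).1.1 (h.trans (map_zero ι).symm)

/-- **Local norms from the compositum have trivial symbol**: if `x ∈ N_{K_vL/K_v}((K_vL)ˣ)` then
`inv_n (κₙ(x) ∪ [θ·id]) = 0` (the Artin symbol of a local norm fixes `K_vL`, on which `θ = ψ ∘ res_v` vanishes:
`artinIdeleMap_localUnits_eq_one_iff_mem_range_norm` with `artinIdeleMap_localUnits_canonicalArtin_eq_inv`).
[cite: SerreLocalFields1979, XIV §1 Prop. 2 Cor. 1] [cite: NeukirchANT1999, Ch. VI §5 Cor. (5.8)] -/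
theorem invLevel_cupProduct_δ₀_scalarCocycle_eq_zero_of_mem_range_norm
    (ψ : CyclicCharacter (absoluteGaloisGroup K) n) (hker : ψ.ker = galFixing K L)
    (θ : CyclicCharacter (absoluteGaloisGroup (v.adicCompletion K)) n)
    (hθ : ∀ σ : absoluteGaloisGroup (v.adicCompletion K), ψ (absGaloisRestrict K (v.adicCompletion K) σ) = θ σ)
    (x : (v.adicCompletion K)ˣ)
    (hxN : x ∈ (Units.map (Algebra.norm (v.adicCompletion K) :
        (IntermediateField.adjoin (v.adicCompletion K)
          (Set.range ((absClosureEmbedding K (v.adicCompletion K)).comp L.val))) →* v.adicCompletion K)).range) :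
    haveI : CompactSpace (absoluteGaloisGroup (v.adicCompletion K)) := absoluteGaloisGroup_compactSpace _
    haveI : CharZero (v.adicCompletion K) := charZero_adicCompletion v
    invLevel (v.adicCompletion K) n (((mu (v.adicCompletion K) n).tateDualPairing n).cupProduct
        ((isSES_kummer (v.adicCompletion K) n (NeZero.pos n)).δ₀
          (baseUnitsInvariant (v.adicCompletion K) (x : v.adicCompletion K) x.ne_zero))
        (oneCocycleClass _ (scalarCocycle θ))) = 0 := by
  haveI : CompactSpace (absoluteGaloisGroup (v.adicCompletion K)) := absoluteGaloisGroup_compactSpace _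
  haveI : CharZero (v.adicCompletion K) := charZero_adicCompletion v
  obtain ⟨w, hw⟩ := (isLocalArtinMap_canonicalArtin_holds (v.adicCompletion K)).isOpenQuotientMap_artin.surjective x
  obtain ⟨ψbar, hψbar_apply⟩ := exists_character_absRestrictNormalHom_eq L ψ hker
  have h := invLevel_cupProduct_δ₀_scalarCocycle_eq_neg_apply_of_restrict L v ψ hker θ hθ (x : v.adicCompletion K)
    x.ne_zero w (by rw [hw])
  have hone : artinIdeleMap L artinReciprocity_character_holds (localUnits v x) = 1 :=
    (artinIdeleMap_localUnits_eq_one_iff_mem_range_norm L x).mpr hxN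
  rw [← hw, artinIdeleMap_localUnits_canonicalArtin_eq_inv L w, inv_eq_one] at hone
  have hψ0 : ψ (absGaloisRestrict K (v.adicCompletion K) (WeilGroup.toAbsGalois (v.adicCompletion K) w)) = 0 := by
    have e := hψbar_apply (absGaloisRestrict K (v.adicCompletion K) (WeilGroup.toAbsGalois (v.adicCompletion K) w))
    rw [hone, map_one] at e
    exact (ofAdd_eq_one.mp e.symm)
  rw [h, ← hθ, hψ0, neg_zero]

end LocalB

end Literature.NumberTheory.GaloisCohomology

end
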